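import Summits.FinalStateConjecture.FinalStateConjecture.Theorems.EIHFluxBalanceInertialRecessionStubEndgameOraclePairSegments
import Summits.FinalStateConjecture.FinalStateConjecture.Theorems.EIHFluxBalanceInertialRecessionStubEndgameOracleStretch
import Summits.FinalStateConjecture.FinalStateConjecture.Theorems.EIHFluxBalanceInertialRecessionStubEndgameOracleTightUniv

/-!
# Route EIHFluxBalance — crux `InertialRecession`, line `sublinear-is-free-clean-window-charges`:
# the increment oracle for a slow PAIR with ballistic outsiders — the two segment bounds of a round

Helper file for the crux `stmt-FinalStateConjecture-10166`
(`Summit.FinalStateConjecture.FinalStateConjecture.Theses.EIHFluxBalance.InertialRecession`), registered stub `stub_incrementOracle`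
(lead reshape r9/r10) of `Cruxes/InertialRecession/Lines/sublinear_is_free_clean_window_charges.lean`; lead's roadmap §9 (`|S| = 2`).

`pair_pieces`: the two segment bounds used by `pair_round` (`…OraclePairRound`): (1) on a GOOD interval of the compact phase (every
outsider at distance `≥ 3‖ξₗ − ξₖ‖` from the reference `k`) ONE pair window bounds the pair's increments by `X` (`tight_increment_mixed`);
(2) on a short stretch (`u₂ − u₁ ≤ 15|O|‖ξₗ − ξₖ‖(u₁)/W`) the two singleton windows bound them by `2X` (`singleton_increment_passage` with the
frozen distance `≥ (7/8)‖ξₗ − ξₖ‖(u₁)` and the passage cost `≤ 19|O|/(W√A₀)`).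
-/

noncomputable section

set_option linter.dupNamespace false

open Filter Topology Set MeasureTheory intervalIntegral
open scoped Topology BigOperators InnerProductSpace RealInnerProductSpace

namespace Summit.FinalStateConjecture.FinalStateConjecture.Theorems.SublinearIsFree.Oracle

open Literature.Geometry.Lorentzian
open Summit.FinalStateConjecture.FinalStateConjecture.Theorems.SublinearIsFree.Endgame

set_option maxHeartbeats 3200000 in
/-- **THE TWO SEGMENT BOUNDS OF A ROUND (slow pair, ballistic outsiders).** See the module docstring. [folklore] -/
theorem pair_pieces {N : ℕ} (M : Fin N → ℝ) (ξ v : Fin N → ℝ → E3) (κ : ℝ) (P : ℝ → E3 → ℝ → Fin 4 → ℝ)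
    (ρ : ℝ → ℝ) (C T T' T₀ : ℝ) (ζ : ℝ → ℝ)
    (hWL : ∀ (t₁ t₂ : ℝ) (c : ℝ → E3) (R : ℝ → ℝ), T ≤ t₁ → t₁ ≤ t₂ →
      (∀ s ∈ Set.Icc t₁ t₂, ∀ s' ∈ Set.Icc t₁ t₂, ‖c s - c s'‖ ≤ 2 * |s - s'| ∧ |R s - R s'| ≤ 2 * |s - s'|) →
      (∀ s ∈ Set.Icc t₁ t₂, ρ s ≤ (1 / 2) * R s ∧ ‖c s‖ + R s ≤ (κ + κ ^ 2) / 2 * s ∧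
        ∀ j, ‖ξ j s - c s‖ ≤ (1 - 1 / 2) * R s ∨ (1 + 1 / 2) * R s ≤ ‖ξ j s - c s‖) →
      ∀ μ : Fin 4, |P t₂ (c t₂) (R t₂) μ - P t₁ (c t₁) (R t₁) μ| ≤ C * ∫ s in t₁..t₂, (R s ^ (3 / 2 : ℝ))⁻¹)
    (hID : ∀ (t : ℝ) (c : E3) (R : ℝ) (A : Finset (Fin N)), T' ≤ t → ρ t ≤ (1 / 2) * R →
      ‖c‖ + R ≤ (κ + κ ^ 2) / 2 * t →
      (∀ j, ‖ξ j t - c‖ ≤ (1 - 1 / 2) * R ∨ (1 + 1 / 2) * R ≤ ‖ξ j t - c‖) →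
      (∀ j, j ∈ A ↔ ‖ξ j t - c‖ ≤ (1 - 1 / 2) * R) →
      |P t c R 0 - ∑ j ∈ A, M j * (√(1 - ‖v j t‖ ^ 2))⁻¹| ≤ ζ t ∧
      ∀ k : Fin 3, |P t c R k.succ - ∑ j ∈ A, M j * (√(1 - ‖v j t‖ ^ 2))⁻¹ * v j t k| ≤ ζ t)
    (hC : 0 ≤ C) (hκ0 : 0 < κ) (hκ1 : κ < 1)
    (hξ : ∀ i, ContDiff ℝ 1 (ξ i)) (hspeed1 : ∀ i s, T₀ ≤ s → ‖deriv (ξ i) s‖ ≤ 1)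
    {k l : Fin N} (hkl : k ≠ l)
    {a b W A₀ σ ζstar : ℝ} (hT : T ≤ a) (hT' : T' ≤ a) (hT₀ : T₀ ≤ a) (ha : 0 < a)
    (hW : 0 < W) (hA₀ : 0 < A₀) (hσ0 : 0 ≤ σ) (hσ2 : 120 * (Finset.univ \ {k, l} : Finset (Fin N)).card * σ ≤ W)
    (hcone : ∀ i, ∀ s ∈ Set.Icc a b, ‖ξ i s‖ ≤ κ ^ 2 * s)
    (n : Fin N → Fin N → E3) (hn : ∀ i ∈ ({k, l} : Finset (Fin N)), ∀ m ∈ Finset.univ \ {k, l}, ‖n i m‖ = 1)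
    (hball : ∀ i ∈ ({k, l} : Finset (Fin N)), ∀ m ∈ Finset.univ \ {k, l}, ∀ s ∈ Icc a b,
      W / 2 ≤ ⟪deriv (ξ m) s - deriv (ξ i) s, n i m⟫)
    (hfar : ∀ i j, i ≠ j → ∀ s ∈ Icc a b, A₀ ≤ ‖ξ i s - ξ j s‖)
    (hslow : ∀ s ∈ Icc a b, ∀ s' ∈ Icc a b, s ≤ s' → |‖ξ l s' - ξ k s'‖ - ‖ξ l s - ξ k s‖| ≤ σ * (s' - s))
    (hβ : ∀ s ∈ Icc a b, ‖ξ l s - ξ k s‖ ≤ (κ - κ ^ 2) / 2 * s / 2)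
    (hρ : ∀ s ∈ Set.Icc a b, (∀ i j, i ≠ j → ρ s ≤ ‖ξ i s - ξ j s‖ / 3) ∧ ρ s ≤ (κ - κ ^ 2) / 2 * s / 2)
    (hζ : ∀ s ∈ Set.Icc a b, ζ s ≤ ζstar) :
    (∀ u₁ u₂ : ℝ, a ≤ u₁ → u₁ ≤ u₂ → u₂ ≤ b → (Finset.univ \ {k, l} : Finset (Fin N)).Nonempty →
      (∀ s ∈ Set.Icc u₁ u₂, ∀ m ∈ (Finset.univ \ {k, l} : Finset (Fin N)), 3 * ‖ξ l s - ξ k s‖ ≤ ‖ξ m s - ξ k s‖) →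
      |∑ j ∈ ({k, l} : Finset (Fin N)), M j * (√(1 - ‖v j u₂‖ ^ 2))⁻¹ - ∑ j ∈ ({k, l} : Finset (Fin N)), M j * (√(1 - ‖v j u₁‖ ^ 2))⁻¹| ≤
        (C * (2 * (((κ - κ ^ 2) / 2) ^ (3 / 2 : ℝ))⁻¹ * (a ^ (1 / 2 : ℝ))⁻¹ +
            (Finset.univ \ {k, l} : Finset (Fin N)).card * (2 * (2 * √2 * (8 / (W * √A₀)))) +
            2 * (19 * (Finset.univ \ {k, l} : Finset (Fin N)).card / (W * √A₀))) + 2 * ζstar) ∧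
      ∀ kk : Fin 3, |∑ j ∈ ({k, l} : Finset (Fin N)), M j * (√(1 - ‖v j u₂‖ ^ 2))⁻¹ * v j u₂ kk -
          ∑ j ∈ ({k, l} : Finset (Fin N)), M j * (√(1 - ‖v j u₁‖ ^ 2))⁻¹ * v j u₁ kk| ≤
        (C * (2 * (((κ - κ ^ 2) / 2) ^ (3 / 2 : ℝ))⁻¹ * (a ^ (1 / 2 : ℝ))⁻¹ +
            (Finset.univ \ {k, l} : Finset (Fin N)).card * (2 * (2 * √2 * (8 / (W * √A₀)))) +
            2 * (19 * (Finset.univ \ {k, l} : Finset (Fin N)).card / (W * √A₀))) + 2 * ζstar)) ∧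
    (∀ u₁ u₂ : ℝ, a ≤ u₁ → u₁ ≤ u₂ → u₂ ≤ b →
      u₂ - u₁ ≤ 15 * (Finset.univ \ {k, l} : Finset (Fin N)).card * ‖ξ l u₁ - ξ k u₁‖ / W →
      |∑ j ∈ ({k, l} : Finset (Fin N)), M j * (√(1 - ‖v j u₂‖ ^ 2))⁻¹ - ∑ j ∈ ({k, l} : Finset (Fin N)), M j * (√(1 - ‖v j u₁‖ ^ 2))⁻¹| ≤
        2 * (C * (2 * (((κ - κ ^ 2) / 2) ^ (3 / 2 : ℝ))⁻¹ * (a ^ (1 / 2 : ℝ))⁻¹ +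
            (Finset.univ \ {k, l} : Finset (Fin N)).card * (2 * (2 * √2 * (8 / (W * √A₀)))) +
            2 * (19 * (Finset.univ \ {k, l} : Finset (Fin N)).card / (W * √A₀))) + 2 * ζstar) ∧
      ∀ kk : Fin 3, |∑ j ∈ ({k, l} : Finset (Fin N)), M j * (√(1 - ‖v j u₂‖ ^ 2))⁻¹ * v j u₂ kk -
          ∑ j ∈ ({k, l} : Finset (Fin N)), M j * (√(1 - ‖v j u₁‖ ^ 2))⁻¹ * v j u₁ kk| ≤
        2 * (C * (2 * (((κ - κ ^ 2) / 2) ^ (3 / 2 : ℝ))⁻¹ * (a ^ (1 / 2 : ℝ))⁻¹ +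
            (Finset.univ \ {k, l} : Finset (Fin N)).card * (2 * (2 * √2 * (8 / (W * √A₀)))) +
            2 * (19 * (Finset.univ \ {k, l} : Finset (Fin N)).card / (W * √A₀))) + 2 * ζstar)) := by
  classical
  -- constants and notation
  set c₀ : ℝ := (κ - κ ^ 2) / 2 with hc₀def
  have hκκ : 0 < κ - κ ^ 2 := by nlinarith
  have hc₀ : 0 < c₀ := by positivity
  set O : Finset (Fin N) := Finset.univ \ {k, l} with hOdef
  have hmemO : ∀ m, m ∈ O ↔ m ≠ k ∧ m ≠ l := fun m ↦ by simp [hOdef]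
  set X : ℝ := C * (2 * (c₀ ^ (3 / 2 : ℝ))⁻¹ * (a ^ (1 / 2 : ℝ))⁻¹ + O.card * (2 * (2 * √2 * (8 / (W * √A₀)))) +
      2 * (19 * O.card / (W * √A₀))) + 2 * ζstar with hX
  set d : ℝ → ℝ := fun s ↦ ‖ξ l s - ξ k s‖ with hd
  set E : ℝ → ℝ := fun s ↦ ∑ j ∈ ({k, l} : Finset (Fin N)), M j * (√(1 - ‖v j s‖ ^ 2))⁻¹ with hE
  set Pk : Fin 3 → ℝ → ℝ := fun kk s ↦ ∑ j ∈ ({k, l} : Finset (Fin N)), M j * (√(1 - ‖v j s‖ ^ 2))⁻¹ * v j s kk with hPk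
  have hkmem : k ∈ ({k, l} : Finset (Fin N)) := by simp
  have hlmem : l ∈ ({k, l} : Finset (Fin N)) := by simp
  have hdpos : ∀ s ∈ Set.Icc a b, 0 < d s := fun s hs ↦ hA₀.trans_le (hfar l k hkl.symm s hs)
  have hζ2 : ∀ s ∈ Set.Icc a b, ∀ s' ∈ Set.Icc a b, ζ s + ζ s' ≤ 2 * ζstar := fun s hs s' hs' ↦ by
    linarith [hζ s hs, hζ s' hs']
  have ha_rpow : ∀ s, a ≤ s → (s ^ (1 / 2 : ℝ))⁻¹ ≤ (a ^ (1 / 2 : ℝ))⁻¹ := fun s hs ↦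
    inv_anti₀ (Real.rpow_pos_of_pos ha _) (Real.rpow_le_rpow ha.le hs (by norm_num))
  have hdslow : ∀ s ∈ Icc a b, ∀ s' ∈ Icc a b, s ≤ s' → |d s' - d s| ≤ σ * (s' - s) := hslow
  have pairSeg : ∀ u₁ u₂, a ≤ u₁ → u₁ ≤ u₂ → u₂ ≤ b → O.Nonempty →
      (∀ s ∈ Set.Icc u₁ u₂, ∀ m ∈ O, 3 * ‖ξ l s - ξ k s‖ ≤ ‖ξ m s - ξ k s‖) →
      |E u₂ - E u₁| ≤ X ∧ ∀ kk, |Pk kk u₂ - Pk kk u₁| ≤ X := by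
    intro u₁ u₂ h1 h12 h2b hOne hgood
    have hsub : ∀ s ∈ Set.Icc u₁ u₂, s ∈ Set.Icc a b := fun s hs ↦ ⟨h1.trans hs.1, hs.2.trans h2b⟩
    have hSc : (Finset.univ \ ({k, l} : Finset (Fin N))).Nonempty := hOne
    have hmin : ∀ s ∈ Set.Icc u₁ u₂, ‖ξ l s - ξ k s‖ ≤ min (c₀ * s)
        (2 / 3 * (Finset.univ \ ({k, l} : Finset (Fin N))).inf' hSc fun j ↦ ‖ξ j s - ξ k s‖) / 2 := by
      intro s hs
      have hb1 : ‖ξ l s - ξ k s‖ ≤ c₀ * s / 2 := hβ s (hsub s hs)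
      have hb2 : 3 * ‖ξ l s - ξ k s‖ ≤ (Finset.univ \ ({k, l} : Finset (Fin N))).inf' hSc fun j ↦ ‖ξ j s - ξ k s‖ :=
        Finset.le_inf' _ _ fun j hj ↦ hgood s hs j hj
      rw [le_div_iff₀ (by norm_num : (0 : ℝ) < 2), le_min_iff]
      constructor <;> linarith
    have hρ' : ∀ s ∈ Set.Icc u₁ u₂, ρ s ≤ min (c₀ * s)
        (2 / 3 * (Finset.univ \ ({k, l} : Finset (Fin N))).inf' hSc fun j ↦ ‖ξ j s - ξ k s‖) / 2 := by
      intro s hs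
      have h := hρ s (hsub s hs)
      have h2 : ρ s ≤ c₀ * s / 2 := h.2
      have hb2 : 3 * ρ s ≤ (Finset.univ \ ({k, l} : Finset (Fin N))).inf' hSc fun j ↦ ‖ξ j s - ξ k s‖ :=
        Finset.le_inf' _ _ fun j hj ↦ by
          have := h.1 j k ((hmemO j).mp hj).1
          linarith
      rw [le_div_iff₀ (by norm_num : (0 : ℝ) < 2), le_min_iff]
      constructor <;> linarith
    have htight : ∀ s ∈ Set.Icc u₁ u₂, ∀ i ∈ ({k, l} : Finset (Fin N)), ‖ξ i s - ξ k s‖ ≤ min (c₀ * s)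
        (2 / 3 * (Finset.univ \ ({k, l} : Finset (Fin N))).inf' hSc fun j ↦ ‖ξ j s - ξ k s‖) / 2 := by
      intro s hs i hi
      rcases Finset.mem_insert.mp hi with h | h
      · subst h; simp only [sub_self, norm_zero]
        exact (norm_nonneg (ξ l s - ξ i s)).trans (hmin s hs)
      · have : i = l := by simpa using h
        subst this; exact hmin s hs
    have h := tight_increment_mixed M ξ v κ P ρ C T T' T₀ ζ hWL hID hC hκ0 hκ1 hξ hspeed1
      (S := {k, l}) (B := Finset.univ \ {k, l}) (F := ∅) (a := k) hSc (fun j hj ↦ Or.inl hj)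
      (hT.trans h1) (hT'.trans h1) (hT₀.trans h1) (ha.trans_le h1) h12 hW hA₀ one_pos
      (fun s hs ↦ hcone k s (hsub s hs)) (n k) (fun j hj ↦ hn k hkmem j hj)
      (fun j hj s hs ↦ hball k hkmem j hj s (hsub s hs))
      (fun j hj s hs ↦ by
        have := hfar k j (((hmemO j).mp hj).1).symm s (hsub s hs); rwa [norm_sub_rev] at this)
      (fun j hj ↦ absurd hj (Finset.notMem_empty j)) hρ' htight
    have hb : C * (2 * (((κ - κ ^ 2) / 2) ^ (3 / 2 : ℝ))⁻¹ * (u₁ ^ (1 / 2 : ℝ))⁻¹ +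
        (Finset.univ \ ({k, l} : Finset (Fin N))).card * (2 * (2 * √2 * (8 / (W * √A₀)))) +
        (∅ : Finset (Fin N)).card * (2 * (2 * ((1 : ℝ) ^ (3 / 2 : ℝ))⁻¹ * (u₁ ^ (1 / 2 : ℝ))⁻¹))) + ζ u₁ + ζ u₂ ≤ X := by
      rw [hX, ← hc₀def, Finset.card_empty, Nat.cast_zero, zero_mul, add_zero]
      have h1' := ha_rpow u₁ h1
      have hc32 : 0 ≤ (c₀ ^ (3 / 2 : ℝ))⁻¹ := inv_nonneg.mpr (Real.rpow_nonneg hc₀.le _)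
      have h2 : C * (2 * (c₀ ^ (3 / 2 : ℝ))⁻¹ * (u₁ ^ (1 / 2 : ℝ))⁻¹) ≤ C * (2 * (c₀ ^ (3 / 2 : ℝ))⁻¹ * (a ^ (1 / 2 : ℝ))⁻¹) :=
        mul_le_mul_of_nonneg_left (mul_le_mul_of_nonneg_left h1' (by positivity)) hC
      have h3 : 0 ≤ C * (2 * (19 * O.card / (W * √A₀))) := by positivity
      have h4 := hζ2 u₁ ⟨h1, h12.trans h2b⟩ u₂ ⟨h1.trans h12, h2b⟩
      nlinarith [h2, h3, h4]
    refine ⟨?_, fun kk ↦ ?_⟩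
    · simpa only [hE] using h.1.trans hb
    · simpa only [hPk] using (h.2 kk).trans hb
  have singSeg : ∀ u₁ u₂, a ≤ u₁ → u₁ ≤ u₂ → u₂ ≤ b → u₂ - u₁ ≤ 15 * O.card * d u₁ / W →
      |E u₂ - E u₁| ≤ 2 * X ∧ ∀ kk, |Pk kk u₂ - Pk kk u₁| ≤ 2 * X := by
    intro u₁ u₂ h1 h12 h2b hlen
    have hsub : ∀ s ∈ Set.Icc u₁ u₂, s ∈ Set.Icc a b := fun s hs ↦ ⟨h1.trans hs.1, hs.2.trans h2b⟩
    have hd1 : 0 < d u₁ := hdpos u₁ ⟨h1, h12.trans h2b⟩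
    -- frozen distance: `d s ≥ (7/8) d u₁` on the stretch
    set A₁ : ℝ := 7 / 8 * d u₁ with hA₁
    have hA₁pos : 0 < A₁ := by positivity
    have hfrozen : ∀ s ∈ Set.Icc u₁ u₂, A₁ ≤ d s := by
      intro s hs
      have h := hdslow u₁ ⟨h1, h12.trans h2b⟩ s (hsub s hs) hs.1
      rw [abs_le] at h
      have hO0 : (0 : ℝ) ≤ O.card := Nat.cast_nonneg _
      have hsl : σ * (s - u₁) ≤ σ * (15 * O.card * d u₁ / W) := mul_le_mul_of_nonneg_left (by linarith [hs.2]) hσ0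
      have h15 : σ * (15 * O.card * d u₁ / W) ≤ d u₁ / 8 := by
        rw [show σ * (15 * O.card * d u₁ / W) = (15 * O.card * σ) * d u₁ / W by ring, div_le_iff₀ hW]
        have : 15 * O.card * σ ≤ W / 8 := by nlinarith [hσ2]
        nlinarith
      rw [hA₁]; linarith [h.1]
    -- the passage cost term
    have hGterm : (u₂ - u₁) * (A₁ * √A₁)⁻¹ ≤ 19 * O.card / (W * √A₀) := by
      have hsq : 14 / 15 * √(d u₁) ≤ √A₁ := by
        rw [hA₁, Real.sqrt_mul (by norm_num)]
        have : (14 / 15 : ℝ) ≤ √(7 / 8) := by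
          rw [show (14 / 15 : ℝ) = √((14 / 15) ^ 2) by rw [Real.sqrt_sq (by norm_num)]]
          exact Real.sqrt_le_sqrt (by norm_num)
        nlinarith [Real.sqrt_nonneg (d u₁)]
      have hsd : 0 < √(d u₁) := Real.sqrt_pos.mpr hd1
      have hden : 7 / 8 * d u₁ * (14 / 15 * √(d u₁)) ≤ A₁ * √A₁ := by
        rw [hA₁] at hsq ⊢
        exact mul_le_mul_of_nonneg_left hsq (by positivity)
      have hden0 : 0 < 7 / 8 * d u₁ * (14 / 15 * √(d u₁)) := by positivity
      have hO0 : (0 : ℝ) ≤ O.card := Nat.cast_nonneg _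
      calc (u₂ - u₁) * (A₁ * √A₁)⁻¹ ≤ (15 * O.card * d u₁ / W) * (7 / 8 * d u₁ * (14 / 15 * √(d u₁)))⁻¹ := by
            refine mul_le_mul hlen (inv_anti₀ hden0 hden) (inv_nonneg.mpr (by positivity)) (by positivity)
        _ = (1800 / 98) * O.card / (W * √(d u₁)) := by
            field_simp
            ring
        _ ≤ 19 * O.card / (W * √(d u₁)) := by
            rw [div_le_div_iff_of_pos_right (by positivity)]
            nlinarith
        _ ≤ 19 * O.card / (W * √A₀) := by
            refine div_le_div_of_nonneg_left (by positivity) (by positivity) ?_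
            exact mul_le_mul_of_nonneg_left (Real.sqrt_le_sqrt (hfar l k hkl.symm u₁ ⟨h1, h12.trans h2b⟩)) hW.le
    -- singleton `k`
    have hρk : ∀ s ∈ Set.Icc u₁ u₂, (∀ j, j ≠ k → ρ s ≤ ‖ξ j s - ξ k s‖ / 3) ∧ ρ s ≤ (κ - κ ^ 2) / 2 * s / 2 :=
      fun s hs ↦ ⟨fun j hj ↦ (hρ s (hsub s hs)).1 j k hj, (hρ s (hsub s hs)).2⟩
    have hk1 := singleton_increment_passage M ξ v κ P ρ C T T' T₀ ζ hWL hID hC hκ0 hκ1 hξ hspeed1 hkl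
      (hT.trans h1) (hT'.trans h1) (hT₀.trans h1) (ha.trans_le h1) h12 hW hA₀ hA₁pos
      (fun s hs ↦ hcone k s (hsub s hs)) (n k) (fun j hj ↦ hn k hkmem j hj)
      (fun j hj s hs ↦ hball k hkmem j hj s (hsub s hs))
      (fun j hj s hs ↦ by
        have := hfar k j (((hmemO j).mp hj).1).symm s (hsub s hs); rwa [norm_sub_rev] at this)
      (fun s hs ↦ hfrozen s hs) hρk
    -- singleton `l`
    have hρl : ∀ s ∈ Set.Icc u₁ u₂, (∀ j, j ≠ l → ρ s ≤ ‖ξ j s - ξ l s‖ / 3) ∧ ρ s ≤ (κ - κ ^ 2) / 2 * s / 2 :=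
      fun s hs ↦ ⟨fun j hj ↦ (hρ s (hsub s hs)).1 j l hj, (hρ s (hsub s hs)).2⟩
    have hpair : ({l, k} : Finset (Fin N)) = {k, l} := Finset.pair_comm l k
    have hl1 := singleton_increment_passage M ξ v κ P ρ C T T' T₀ ζ hWL hID hC hκ0 hκ1 hξ hspeed1 hkl.symm
      (hT.trans h1) (hT'.trans h1) (hT₀.trans h1) (ha.trans_le h1) h12 hW hA₀ hA₁pos
      (fun s hs ↦ hcone l s (hsub s hs)) (n l) (fun j hj ↦ hn l hlmem j (by rwa [hpair] at hj))
      (fun j hj s hs ↦ hball l hlmem j (by rwa [hpair] at hj) s (hsub s hs))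
      (fun j hj s hs ↦ by
        have hj' : j ∈ O := by rwa [hpair] at hj
        have := hfar l j (((hmemO j).mp hj').2).symm s (hsub s hs); rwa [norm_sub_rev] at this)
      (fun s hs ↦ by rw [norm_sub_rev]; exact hfrozen s hs) hρl
    rw [hpair] at hl1
    -- the common bound
    have hb : C * (2 * (((κ - κ ^ 2) / 2) ^ (3 / 2 : ℝ))⁻¹ * (u₁ ^ (1 / 2 : ℝ))⁻¹ +
        (Finset.univ \ ({k, l} : Finset (Fin N))).card * (2 * (2 * √2 * (8 / (W * √A₀)))) +
        2 * ((u₂ - u₁) * (A₁ * √A₁)⁻¹)) + ζ u₁ + ζ u₂ ≤ X := by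
      rw [hX, ← hc₀def]
      have h1' := ha_rpow u₁ h1
      have h2 : C * (2 * (c₀ ^ (3 / 2 : ℝ))⁻¹ * (u₁ ^ (1 / 2 : ℝ))⁻¹) ≤ C * (2 * (c₀ ^ (3 / 2 : ℝ))⁻¹ * (a ^ (1 / 2 : ℝ))⁻¹) :=
        mul_le_mul_of_nonneg_left (mul_le_mul_of_nonneg_left h1' (by positivity)) hC
      have h3 : C * (2 * ((u₂ - u₁) * (A₁ * √A₁)⁻¹)) ≤ C * (2 * (19 * O.card / (W * √A₀))) :=
        mul_le_mul_of_nonneg_left (by linarith [hGterm]) hC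
      have h4 := hζ2 u₁ ⟨h1, h12.trans h2b⟩ u₂ ⟨h1.trans h12, h2b⟩
      nlinarith [h2, h3, h4]
    have hEk := hk1.1.trans hb
    have hEl := hl1.1.trans hb
    refine ⟨?_, fun kk ↦ ?_⟩
    · simp only [hE, Finset.sum_pair hkl]
      calc |M k * (√(1 - ‖v k u₂‖ ^ 2))⁻¹ + M l * (√(1 - ‖v l u₂‖ ^ 2))⁻¹ -
            (M k * (√(1 - ‖v k u₁‖ ^ 2))⁻¹ + M l * (√(1 - ‖v l u₁‖ ^ 2))⁻¹)|
          = |(M k * (√(1 - ‖v k u₂‖ ^ 2))⁻¹ - M k * (√(1 - ‖v k u₁‖ ^ 2))⁻¹) +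
            (M l * (√(1 - ‖v l u₂‖ ^ 2))⁻¹ - M l * (√(1 - ‖v l u₁‖ ^ 2))⁻¹)| := by ring_nf
        _ ≤ _ := abs_add_le _ _
        _ ≤ 2 * X := by linarith
    · have hPk1 := (hk1.2 kk).trans hb
      have hPl1 := (hl1.2 kk).trans hb
      simp only [hPk, Finset.sum_pair hkl]
      calc |M k * (√(1 - ‖v k u₂‖ ^ 2))⁻¹ * v k u₂ kk + M l * (√(1 - ‖v l u₂‖ ^ 2))⁻¹ * v l u₂ kk -
            (M k * (√(1 - ‖v k u₁‖ ^ 2))⁻¹ * v k u₁ kk + M l * (√(1 - ‖v l u₁‖ ^ 2))⁻¹ * v l u₁ kk)|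
          = |(M k * (√(1 - ‖v k u₂‖ ^ 2))⁻¹ * v k u₂ kk - M k * (√(1 - ‖v k u₁‖ ^ 2))⁻¹ * v k u₁ kk) +
            (M l * (√(1 - ‖v l u₂‖ ^ 2))⁻¹ * v l u₂ kk - M l * (√(1 - ‖v l u₁‖ ^ 2))⁻¹ * v l u₁ kk)| := by ring_nf
        _ ≤ _ := abs_add_le _ _
        _ ≤ 2 * X := by linarith
  refine ⟨fun u₁ u₂ h1 h12 h2b hOne hgood ↦ ?_, fun u₁ u₂ h1 h12 h2b hlen ↦ ?_⟩
  · have h := pairSeg u₁ u₂ h1 h12 h2b hOne hgood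
    refine ⟨?_, fun kk ↦ ?_⟩
    · simpa only [hE, hX, hc₀def, hOdef] using h.1
    · simpa only [hPk, hX, hc₀def, hOdef] using h.2 kk
  · have h := singSeg u₁ u₂ h1 h12 h2b (by simpa only [hd, hOdef] using hlen)
    refine ⟨?_, fun kk ↦ ?_⟩
    · simpa only [hE, hX, hc₀def, hOdef] using h.1
    · simpa only [hPk, hX, hc₀def, hOdef] using h.2 kk

/-- Registered helper form: the unordered pair contains both of its elements (carrier of this file). [folklore] -/
theorem oracle_mem_pair_right : ∀ (N : ℕ) (k l : Fin N), l ∈ ({k, l} : Finset (Fin N)) := by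
  intro N k l; simp

end Summit.FinalStateConjecture.FinalStateConjecture.Theorems.SublinearIsFree.Oracle

end
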